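import Summits.BirchSwinnertonDyer.BirchSwinnertonDyer.Theorems.UniversalToricDescentSigmaLocalProduct
import Summits.BirchSwinnertonDyer.BirchSwinnertonDyer.Theorems.UniversalToricDescentInvariantsTransportTAlgebraicHalf
import HarnessLib

/-!
# Route UniversalToricDescent — the algebraic half of child 21845 with the `Σ`-terms LOCALISED:
# `3^{λ_alg(E)} · ∏_{v∈Σ} (#H¹(K_{∞,w_v}, E[3^∞])[3])^{3^{c_v}} = 3^{n′} · ∏_{v∈Σ} (#H¹(K_{∞,w_v}, E′[3^∞])[3])^{3^{c_v}}`

Lead prover bsd-wall-utd-p1 g8 (`--supports stmt-BirchSwinnertonDyer-20399`; memo ALG-HALF-21845-STATUS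
§3 (d), closing the loop). g7's `invariantsTransportT_algebraicHalf_of_baseFinite` left the two finite
groups `B^Σ[3] = (Sel^Σ/Sel^∅)[3]` of `E` and `E′` unidentified; `UniversalToricDescentSigmaLocalProduct`
(Greenberg–Vatsal Cor. (2.3) + (2.10) over `K_∞`, this generation) computes them as products of LOCAL terms
over the places `v ∈ Σ` (`3^{c_v}` = number of places of `K_∞` above `v`, `H¹(H ∩ D_v, ·) = H¹(K_{∞,w_v}, ·)`):

* §1 `natCard_quotient_pTorsion_baseChange_eq_prod_of_noPTorsionPadic` — one curve `E/ℚ` over an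
  imaginary quadratic `K` with `p` split, (iv), degree-one `𝔭`, base finiteness at `v ∣ p`, Poitou–Tate ×2,
  a finite `Σ` of places `v ∤ p` with exact indices and `Sel^Σ[p]` finite:
  `#(Sel^Σ/Sel^∅)[p] = ∏_{v∈Σ} (#H¹(H ∩ D_v, E[p^∞])[p])^{p^{c_v}}`.
* §2 **`invariantsTransportT_algebraicHalf_local`** — in the binders of 21845 (as
  `invariantsTransportT_algebraicHalf_of_baseFinite`: wild `E` at `3`, mod-`3` twin `E′`, `K` Heegner for
  `N, N′`, anticyclotomic `κ`, `𝔭′ ∋ 3`, the twin's frame reading at `Σ = ∅`, (iv), base finiteness for `E`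
  and `E′`, Poitou–Tate ×2): `X_{∅,0}(E)` torsion, a generator with profile `λ_alg(E)`, the exact indices
  `c_v` at the bad places `Σ` (finitely decomposed by Brink), and the LOCALISED transport identity above.

HONEST STATUS: helper theorems, CONDITIONAL on the cited Poitou–Tate facts (leaves 20461/20462) and on
base finiteness for the twin (steward note §4); the local terms `#H¹(K_{∞,w_v}, E[3^∞])[3]` (GV Prop. 2.4:
tame inertia at `v` over a split `q ≠ 3`) are left as the interface the analytic `Σ`-Euler factors must
match; the analytic congruence, the frames (20928) and 20395 remain. THEOREMS ONLY; no definition, no named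
fact, no `sorry`. BSD is not advanced by this file.
References: [GreenbergVatsal2000] Thm. (1.4), §2 Cor. (2.3), Prop. (2.4), (2.8), (2.10) (pp. 23–28);
[Brink2007] Thm. 2, Cor. 1; [JetchevSkinnerWan2017] §3.3; [MilneADT2006] I 4.10.
-/

set_option autoImplicit false
-- `…BirchSwinnertonDyer.BirchSwinnertonDyer.Theorems…` is the problem's mandated namespace (D-0017).
set_option linter.dupNamespace false

noncomputable section

open scoped Classical

namespace Summit.BirchSwinnertonDyer.BirchSwinnertonDyer.Theorems.UniversalToricDescentSigmaLocalImage

open Function Field NumberField IsDedekindDomain WeierstrassCurve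
open Literature.NumberTheory.GaloisRepresentations Literature.NumberTheory.EllipticCurves
  Literature.NumberTheory.EllipticCurves.GreenbergSelmer Literature.NumberTheory.GaloisCohomology
  Literature.NumberTheory.EllipticCurves.IwasawaAlgebra Literature.NumberTheory.EllipticCurves.Rank1Residual
  Summit.BirchSwinnertonDyer.Rank1Residual Summit.BirchSwinnertonDyer.Rank1Residual.X11b
  Summit.BirchSwinnertonDyer.Rank1Residual.X11b.Coinv Summit.BirchSwinnertonDyer.Rank1Residual.X11b.AcSelmer
  Summit.BirchSwinnertonDyer.Rank1Residual.X11b.LocBridge Summit.BirchSwinnertonDyer.Rank1Residual.X11b.H2Support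
  Summit.BirchSwinnertonDyer.Rank1Residual.X11b.Levels Summit.BirchSwinnertonDyer.Rank1Residual.Iwasawa
  Summit.BirchSwinnertonDyer.BirchSwinnertonDyer.Theorems.UniversalToricDescentSigmaCoinvariants
  Summit.BirchSwinnertonDyer.BirchSwinnertonDyer.Theorems.UniversalToricDescentSigmaLocalStabilizer
  Summit.BirchSwinnertonDyer.BirchSwinnertonDyer.Theorems.UniversalToricDescentSigmaFree
  Summit.BirchSwinnertonDyer.BirchSwinnertonDyer.Theorems.UniversalToricDescentSigmaPassage
  Summit.BirchSwinnertonDyer.BirchSwinnertonDyer.Theorems.UniversalToricDescentAcDualMuZero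
  Summit.BirchSwinnertonDyer.BirchSwinnertonDyer.Theorems.UniversalToricDescentNoFiniteSubmodule
  Summit.BirchSwinnertonDyer.BirchSwinnertonDyer.Theorems.UniversalToricDescentStrictPlace
  Summit.BirchSwinnertonDyer.BirchSwinnertonDyer.Theorems.UniversalToricDescentLambdaNormProfile
  Summit.BirchSwinnertonDyer.BirchSwinnertonDyer.Theorems.UniversalToricDescentInvariantsTransportT
  Summit.BirchSwinnertonDyer.BirchSwinnertonDyer.Theorems.UniversalToricDescentTorsionMuTransportHeegner

/-! ### §1 One curve over `ℚ`: `#(Sel^Σ/Sel^∅)[p] = ∏_{v∈Σ} (#H¹(H ∩ D_v, E[p^∞])[p])^{p^{c_v}}` -/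

/-- **`#(Sel_𝔭^Σ(K_∞, E[p^∞]) / Sel_𝔭^∅)[p] = ∏_{v∈Σ} (#H¹(H ∩ D_v, E[p^∞])[p])^{p^{c_v}}`** for `E/ℚ`,
`K` imaginary quadratic with `p` split, (iv) `E(ℚ_p)[p] = 0`, a `ℤ_p`-extension `κ` with topological
generator `γ`, a degree-one `𝔭 ∋ p`, `Sel_v(K, E[p^∞])` finite at every `v ∣ p`, a finite `Σ` of places
`v ∤ p` with exact indices `κ(D_v) = p^{c_v} ℤ_p`, and `Sel^Σ[p]` finite — GIVEN the two cited
Poitou–Tate facts. [cite: GreenbergVatsal2000, §2 Cor. (2.3), Prop. (2.4) and (2.10) (pp. 24–28)]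
[cite: JetchevSkinnerWan2017, Prop. 3.3.2 and Lemma 3.3.3 (arXiv:1512.06894 pp. 11–12)] [cite: MilneADT2006, Ch. I, Thm. 4.10] -/
theorem natCard_quotient_pTorsion_baseChange_eq_prod_of_noPTorsionPadic
    (W : WeierstrassCurve ℚ) [W.IsElliptic] [W.IsGloballyMinimal] (p : ℕ) [Fact p.Prime]
    {K : Type} [Field K] [NumberField K]
    (h4 : ∀ R : (W.baseChange ℚ_[p]).toAffine.Point, p • R = 0 → R = 0)
    (hPT : poitouTate_selmerStructure_duality K) (hPT2 : poitouTate_sha_tateDual K)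
    (hK : IsImaginaryQuadratic K) (hsplit : SplitsIn K p)
    (κ : ZpExtension K p) (γ : absoluteGaloisGroup K) [hγ : Fact (κ.IsTopGenerator γ)]
    {𝔭 : HeightOneSpectrum (𝓞 K)} (h𝔭 : ((p : ℕ) : 𝓞 K) ∈ 𝔭.asIdeal)
    (he : 𝔭.asIdeal.ramificationIdx (𝓞 ℚ) = 1) (hf : 𝔭.asIdeal.inertiaDeg (𝓞 ℚ) = 1)
    (hfin : ∀ v : HeightOneSpectrum (𝓞 K), ((p : ℕ) : 𝓞 K) ∈ v.asIdeal →
      Finite (selmerAcBase (W.baseChange K) p v ∅))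
    {S : Set (HeightOneSpectrum (𝓞 K))} (hS : S.Finite)
    (hSp : ∀ v ∈ S, ((p : ℕ) : 𝓞 K) ∉ v.asIdeal) (c : HeightOneSpectrum (𝓞 K) → ℕ)
    (hc : ∀ v ∈ S, ∀ z : ℤ_[p], ∃ d : decomp (K := K) v,
      (κ (d : absoluteGaloisGroup K)).toAdd = (p : ℤ_[p]) ^ c v * z)
    (hle : ∀ v ∈ S, ∀ d : decomp (K := K) v, (p : ℤ_[p]) ^ c v ∣ (κ (d : absoluteGaloisGroup K)).toAdd)
    (hfinS : Set.Finite {s : selmerAc (W.baseChange K) p κ 𝔭 S | p • s = 0}) :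
    Nat.card {b : selmerAc (W.baseChange K) p κ 𝔭 S ⧸
        (selmerAc (W.baseChange K) p κ 𝔭 ∅).addSubgroupOf (selmerAc (W.baseChange K) p κ 𝔭 S) //
          p • b = 0} =
      ∏ v ∈ hS.toFinset, Nat.card {f : subgroupH1 (kerD κ v) ((W.baseChange K).geomPrimaryTorsion p) //
        p • f = 0} ^ (p ^ c v) := by
  haveI : IsTotallyComplex K := hK.2
  obtain ⟨σ, 𝔮, -, hne, h𝔮, -⟩ :=
    LocalIndexTransport.exists_conj_prime_of_splitsIn K p hK.1 hsplit h𝔭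
  have hΓ𝔭 := noInvariantsAt_of_noPTorsion W p h4 K κ 𝔭 h𝔭 he hf
  have hΓ := Coinv.noInvariants_of_noInvariants_at (W.baseChange K) p hΓ𝔭
  have htor := exists_pow_nsmul_local_eq_zero W p hK.1 hsplit
  haveI := hfin 𝔭 h𝔭
  have h2 := WeakLeopoldt.subsingleton_galoisCohomology_two_primary (W.baseChange K) p 𝔭 ∅ hPT2
    (fieldCdLE_two_of_isTotallyComplex fieldCdLE_two_of_numberField_holds K p) hΓ htor
  -- the product theorem at `Σ₀ = ∅`, `T = Σ`, stated for any `S' = ∅ ∪ Σ`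
  have key : ∀ S' : Set (HeightOneSpectrum (𝓞 K)), S' = ∅ ∪ (hS.toFinset : Set (HeightOneSpectrum (𝓞 K))) →
      Set.Finite {s : selmerAc (W.baseChange K) p κ 𝔭 S' | p • s = 0} →
      Nat.card {b : selmerAc (W.baseChange K) p κ 𝔭 S' ⧸
          (selmerAc (W.baseChange K) p κ 𝔭 ∅).addSubgroupOf (selmerAc (W.baseChange K) p κ 𝔭 S') //
            p • b = 0} =
        ∏ v ∈ hS.toFinset, Nat.card {f : subgroupH1 (kerD κ v) ((W.baseChange K).geomPrimaryTorsion p) //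
          p • f = 0} ^ (p ^ c v) := by
    rintro S' rfl hfinS'
    exact natCard_quotient_pTorsion_eq_prod_of_finite (W.baseChange K) p κ hPT
      (fun v ↦ GaloisImage.EP.localEulerPoincareCharacteristic_adicCompletion K v) h𝔭 h𝔮 hne hΓ𝔭
      (hfin 𝔮 h𝔮) h2 γ Set.finite_empty c hS.toFinset
      (fun v hv ↦ hSp v (hS.mem_toFinset.mp hv)) (fun v _ h ↦ h)
      (fun v hv ↦ hc v (hS.mem_toFinset.mp hv)) (fun v hv ↦ hle v (hS.mem_toFinset.mp hv)) hfinS'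
  have e : S = ∅ ∪ (hS.toFinset : Set (HeightOneSpectrum (𝓞 K))) := by
    rw [Set.empty_union, hS.coe_toFinset]
  exact key S e (by exact hfinS)

/-! ### §2 The algebraic half of 21845 with the `Σ`-terms localised -/

/-- **The algebraic half of 21845, `Σ`-terms LOCALISED.** In the binders of
`invariantsTransportT_algebraicHalf_of_baseFinite` (wild `E` at `3`, mod-`3` twin `E′`, `K` imaginary
quadratic Heegner for `N` and `N′`, anticyclotomic `κ` with topological generator `γ`, `𝔭′ ∋ 3`, the twin's
`X_{∅,0}(E′)` torsion with `Ch·R₀⟦T⟧ = (L′)`, `profile_{n′}(L′)`, (iv) `E(ℚ₃)[3] = 0`, base finiteness at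
`v ∣ 3` for `E` and `E′`, Poitou–Tate ×2): with `Σ` the finite set of places `v ∤ 3` where `E_K` or
`E′_K` is bad (finitely decomposed in `K_∞` by the Heegner hypotheses and Brink) and `3^{c_v}` the number
of places of `K_∞` above `v` (exact index `κ(D_v) = 3^{c_v} ℤ₃`): `X_{∅,0}(E)` is torsion, its
characteristic ideal has a generator with norm profile `λ_alg(E)`, and
`3^{λ_alg(E)} · ∏_{v∈Σ} (#H¹(H ∩ D_v, E[3^∞])[3])^{3^{c_v}} = 3^{n′} · ∏_{v∈Σ} (#H¹(H ∩ D_v, E′[3^∞])[3])^{3^{c_v}}`.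
[cite: GreenbergVatsal2000, Thm. (1.4), §2 Cor. (2.3), Prop. (2.4), (2.8), (2.10) (pp. 23–28)]
[cite: Brink2007, Thm. 2 and Cor. 1] [cite: JetchevSkinnerWan2017, Lemma 3.3.3 (arXiv:1512.06894 pp. 11–12)]
[cite: MilneADT2006, Ch. I, Thm. 4.10] -/
theorem invariantsTransportT_algebraicHalf_local (W W' : WeierstrassCurve ℚ) [W.IsElliptic]
    [W.IsGloballyMinimal] [W'.IsElliptic] [W'.IsGloballyMinimal] {N N' : ℕ} (K : Type) [Field K]
    [NumberField K]
    (hO6 : Additive.ClassO6 W 3) (hN : W.conductorNorm ℤ = N) (hcong : O6.ModPCongruent W' W 3)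
    (hN' : W'.conductorNorm ℤ = N') (hK : IsImaginaryQuadratic K)
    (hHe : SatisfiesHeegnerHypothesis N K) (hHe' : SatisfiesHeegnerHypothesis N' K)
    (κ : ZpExtension K 3) (hκ : κ.IsAnticyclotomic) (γ : absoluteGaloisGroup K)
    [Fact (κ.IsTopGenerator γ)] {𝔭' : HeightOneSpectrum (𝓞 K)} (h𝔭' : ((3 : ℕ) : 𝓞 K) ∈ 𝔭'.asIdeal)
    (hT' : Module.IsTorsion (IwasawaAlgebra 3) (XAc (W'.baseChange K) 3 κ 𝔭' ∅ γ))
    {L' : UnrSeries 3} {n' : ℕ}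
    (hL' : (XAc.charIdeal (W'.baseChange K) 3 κ 𝔭' ∅ γ).map (PowerSeries.map (Halves.toUnr 3)) =
      Ideal.span {L'})
    (hn' : (∀ i < n', ‖((PowerSeries.coeff i L' : unrIntegers 3) : ℂ_[3])‖ < 1) ∧
      ‖((PowerSeries.coeff n' L' : unrIntegers 3) : ℂ_[3])‖ = 1)
    (h4 : ∀ R : (W.baseChange ℚ_[3]).toAffine.Point, 3 • R = 0 → R = 0)
    (hPT : poitouTate_selmerStructure_duality K) (hPT2 : poitouTate_sha_tateDual K)
    (hfin : ∀ v : HeightOneSpectrum (𝓞 K), ((3 : ℕ) : 𝓞 K) ∈ v.asIdeal →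
      Finite (selmerAcBase (W.baseChange K) 3 v ∅))
    (hfin' : ∀ v : HeightOneSpectrum (𝓞 K), ((3 : ℕ) : 𝓞 K) ∈ v.asIdeal →
      Finite (selmerAcBase (W'.baseChange K) 3 v ∅)) :
    ∃ (T : Finset (HeightOneSpectrum (𝓞 K))) (c : HeightOneSpectrum (𝓞 K) → ℕ),
      (↑T = {v : HeightOneSpectrum (𝓞 K) | ((3 : ℕ) : 𝓞 K) ∉ v.asIdeal ∧
        (¬ (W.baseChange K).HasGoodReductionAt v ∨ ¬ (W'.baseChange K).HasGoodReductionAt v)}) ∧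
      (∀ v ∈ T, (∃ d₀ : decomp (K := K) v, (κ (d₀ : absoluteGaloisGroup K)).toAdd = (3 : ℤ_[3]) ^ c v) ∧
        ∀ d : decomp (K := K) v, (3 : ℤ_[3]) ^ c v ∣ (κ (d : absoluteGaloisGroup K)).toAdd) ∧
      Module.IsTorsion (IwasawaAlgebra 3) (XAc (W.baseChange K) 3 κ 𝔭' ∅ γ) ∧
      ∃ g : UnrSeries 3,
        (XAc.charIdeal (W.baseChange K) 3 κ 𝔭' ∅ γ).map (PowerSeries.map (Halves.toUnr 3)) =
            Ideal.span {g} ∧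
          (∀ i < lambdaInvariant 3 (XAc (W.baseChange K) 3 κ 𝔭' ∅ γ),
            ‖((PowerSeries.coeff i g : unrIntegers 3) : ℂ_[3])‖ < 1) ∧
          ‖((PowerSeries.coeff (lambdaInvariant 3 (XAc (W.baseChange K) 3 κ 𝔭' ∅ γ)) g :
            unrIntegers 3) : ℂ_[3])‖ = 1 ∧
          3 ^ lambdaInvariant 3 (XAc (W.baseChange K) 3 κ 𝔭' ∅ γ) *
              ∏ v ∈ T, Nat.card {f : subgroupH1 (kerD κ v) ((W.baseChange K).geomPrimaryTorsion 3) //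
                3 • f = 0} ^ (3 ^ c v) =
            3 ^ n' *
              ∏ v ∈ T, Nat.card {f : subgroupH1 (kerD κ v) ((W'.baseChange K).geomPrimaryTorsion 3) //
                3 • f = 0} ^ (3 ^ c v) := by
  haveI : Fact (Nat.Prime 3) := ⟨Nat.prime_three⟩
  -- `Σ` and its finiteness / decomposition data
  set S : Set (HeightOneSpectrum (𝓞 K)) := {v | ((3 : ℕ) : 𝓞 K) ∉ v.asIdeal ∧
    (¬ (W.baseChange K).HasGoodReductionAt v ∨ ¬ (W'.baseChange K).HasGoodReductionAt v)} with hSdef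
  have hSfin : S.Finite := by
    refine (((W.baseChange K).finite_badPlaces_holds (𝓞 K)).union
      ((W'.baseChange K).finite_badPlaces_holds (𝓞 K))).subset fun v hv ↦ ?_
    rcases hv.2 with h | h
    · exact Or.inl h
    · exact Or.inr h
  have hSp : ∀ v ∈ S, ((3 : ℕ) : 𝓞 K) ∉ v.asIdeal := fun v hv ↦ hv.1
  have hSdec : ∀ v ∈ S, ¬ (decomp v ≤ κ.kerSubgroup) := by
    intro v hv
    rcases hv.2 with h | h
    · exact not_decomp_le_kerSubgroup_of_not_hasGoodReductionAt_baseChange W hN K hK hHe (by decide) κ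
        hκ hv.1 h
    · exact not_decomp_le_kerSubgroup_of_not_hasGoodReductionAt_baseChange W' hN' K hK hHe' (by decide)
        κ hκ hv.1 h
  choose! c hc₀ hc hle using fun v (hv : v ∈ S) ↦ exists_pow_and_forall_dvd_of_not_le κ v (hSdec v hv)
  have hgood : ∀ v : HeightOneSpectrum (𝓞 K), v ∉ S → ((3 : ℕ) : 𝓞 K) ∉ v.asIdeal →
      (W.baseChange K).HasGoodReductionAt v := fun v hv hpv ↦ by
    by_contra h
    exact hv ⟨hpv, Or.inl h⟩
  have hgood' : ∀ v : HeightOneSpectrum (𝓞 K), v ∉ S → ((3 : ℕ) : 𝓞 K) ∉ v.asIdeal →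
      (W'.baseChange K).HasGoodReductionAt v := fun v hv hpv ↦ by
    by_contra h
    exact hv ⟨hpv, Or.inr h⟩
  -- arithmetic of the datum
  have hadd : Addv W 3 := hO6.2.1
  have hpN : 3 ∣ W.conductorNorm ℤ :=
    (W.dvd_conductorNorm_iff_not_hasGoodReductionAtPrime 3).mpr hadd.1
  have hsplit : SplitsIn K 3 := hHe 3 (Fact.out) (hN ▸ hpN)
  obtain ⟨he', hf'⟩ := degreeOne_of_splitsIn hK.1 hsplit h𝔭'
  have h4' : ∀ R : (W'.baseChange ℚ_[3]).toAffine.Point, 3 • R = 0 → R = 0 :=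
    (UniversalToricDescentTowerTorsion.baseChange_noPTorsion_iff_of_modPCongruent 3 W W' ℚ_[3] hcong).mp
      h4
  have hnf := forall_finite_eq_bot_baseChange_of_noPTorsionPadic W 3 h4 hPT hPT2 hK hsplit κ γ h𝔭'
    he' hf' hfin
  have hnf' := forall_finite_eq_bot_baseChange_of_noPTorsionPadic W' 3 h4' hPT hPT2 hK hsplit κ γ h𝔭'
    he' hf' hfin'
  -- finiteness of `Sel^Σ[3]` for both curves
  haveI := XAc.module_finite κ 𝔭' (∅ : Set (HeightOneSpectrum (𝓞 K))) γ Set.finite_empty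
    (W := W'.baseChange K)
  have hμ'e : muInvariant 3 (XAc (W'.baseChange K) 3 κ 𝔭' ∅ γ) = 0 :=
    muInvariant_eq_zero_of_map_charIdeal_eq_span (XAc (W'.baseChange K) 3 κ 𝔭' ∅ γ) hT' hL'
      ⟨n', hn'.2⟩
  have hfin'e : Set.Finite {s : selmerAc (W'.baseChange K) 3 κ 𝔭' ∅ | 3 • s = 0} :=
    finite_pTorsion_of_muInvariant_eq_zero (W'.baseChange K) 3 κ 𝔭' ∅ γ hT' hμ'e
  have hfin'S : Set.Finite {s : selmerAc (W'.baseChange K) 3 κ 𝔭' S | 3 • s = 0} :=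
    finite_selmerAc_pTorsion_of_empty (W'.baseChange K) κ hSfin hSp hSdec hfin'e
  have hT'S : Module.IsTorsion (IwasawaAlgebra 3) (XAc (W'.baseChange K) 3 κ 𝔭' S γ) :=
    isTorsion_of_finite_pTorsion (W'.baseChange K) 3 κ 𝔭' S γ hSfin hfin'S
  have hμ'S : muInvariant 3 (XAc (W'.baseChange K) 3 κ 𝔭' S γ) = 0 :=
    muInvariant_eq_zero_of_finite_pTorsion (W'.baseChange K) 3 κ 𝔭' S γ hSfin hfin'S
  have hL := noFixedPTorsion_kerSubgroup_inf_decomp_twin_of_noPTorsionPadic W 3 W' hcong h4 κ h𝔭'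
    he' hf'
  obtain ⟨⟨hTS, hμS⟩, -, -⟩ :=
    pow_lambdaInvariant_mul_natCard_baseChange_eq_of_modPCongruent W W' K κ γ (by decide) h𝔭' hSfin
      hgood hgood' hcong hL hT'S hμ'S hnf' hnf
  haveI := XAc.module_finite κ 𝔭' S γ hSfin (W := W.baseChange K)
  have hfinS : Set.Finite {s : selmerAc (W.baseChange K) 3 κ 𝔭' S | 3 • s = 0} :=
    finite_pTorsion_of_muInvariant_eq_zero (W.baseChange K) 3 κ 𝔭' S γ hTS hμS
  -- the two local products
  have hprod := natCard_quotient_pTorsion_baseChange_eq_prod_of_noPTorsionPadic W 3 h4 hPT hPT2 hK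
    hsplit κ γ h𝔭' he' hf' hfin hSfin hSp c hc hle hfinS
  have hprod' := natCard_quotient_pTorsion_baseChange_eq_prod_of_noPTorsionPadic W' 3 h4' hPT hPT2 hK
    hsplit κ γ h𝔭' he' hf' hfin' hSfin hSp c hc hle hfin'S
  -- g7's assembled algebraic half
  obtain ⟨hT, g, hg, hglt, hgeq, hcount⟩ := invariantsTransportT_algebraicHalf_of_baseFinite W W' K hO6
    hN hcong hN' hK hHe hHe' κ hκ γ h𝔭' hT' hL' hn' h4 hPT hPT2 hfin hfin'
  refine ⟨hSfin.toFinset, c, hSfin.coe_toFinset, fun v hv ↦ ?_, hT, g, hg, hglt, hgeq, ?_⟩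
  · exact ⟨hc₀ v (hSfin.mem_toFinset.mp hv), hle v (hSfin.mem_toFinset.mp hv)⟩
  · rw [← hprod, ← hprod']
    exact hcount

end Summit.BirchSwinnertonDyer.BirchSwinnertonDyer.Theorems.UniversalToricDescentSigmaLocalImage

end
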